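import Summits.QuantumFields.BalabanUV.Beta.GAN24.CombChargeConservationRowContact
import Summits.QuantumFields.BalabanUV.Beta.GAN24.RowCChargeFormsLegSym

/-!
# `BalabanUV.Beta.GAN24.CombChargeConservationRowLegSym` — binder row G-an2-4 ∕ (CONV-C), TRANSFER-III (the (α-0) chain at row D1's literal of record (III′)):
# **THE (III′) END's (C)^{ev} ROW IN ITS WEAKEST CONSERVATION CURRENCY — the G-an2-4 END at row D1's literal of record ⟸ (b) the S-slot rows of `ScombOf` ∧ (d″) «the
# comb-chart `T₂` tower CONSERVES its LEG-AND-BOND-SYMMETRISED ff zero-mode charge, level by level», NOTHING ELSE** — the OWNER g50's `CombChargeConservationRow` (row (d′):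
# BOTH leg orders separately) weakened by leaf-02 g64's (E) recipe `RowCChargeFormsLegSym` §1 (`zsym_halfTable_legSym`: at `ε = 1` the even member needs only the SUM over the
# two leg orders), RE-RUN at the comb-chart slot data `(GcombSh Lc ·, SpureCombOf tabs, tabs.M, tabs.vh₂S, tabs.mixFF)` (OWNER `b2b-balaban-gan24-p1`, gen 51; no existing file touched)

NOT IN PRINT; OUR BOOKKEEPING ([folklore] compositions BY NAME at weight 0; 0 `def`, 0 cited facts, 0 `def … : Prop`, 0 sorry).  HONEST FRAMING (cell contract,
verbatim): «discharging `BetaPertH` makes Bałaban's UV stability UNCONDITIONAL — a real constructive-QFT result; it is NOT the continuum limit and NOT the Clay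
problem.»  HONEST DEPENDENCY (verbatim): «continuum YM on T⁴ ⇐ BetaPertH ∧ nine spine estimates (0/9 proved); BetaPertH ⇐ (D1) ∧ (D4) ∧ CAP+tail; G-an2-4 gates
asym, D1 and NE2/3/4.»

WHY.  The OWNER g50's `CombChargeConservationRow.exists_allScalesSeq_JsB12CombShSym_an1_of_sRows_chargeConserved` displays (d′) «`zmodeSym_Lc (T̃′♮_{l+1}) = zmodeSym_Lc (T̃′♮_l)` at
BOTH leg orders `(κ₁,κ₂)`», which is STRONGER than what leaf-01 g83's END `CombTowerEndAtPin` consumes: its `hC` is the EVEN member's row at `ε = 1`, and at `ε = 1` the parity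
image swaps the two leg fibres (`ZeroModeParity.zmode_sgnK_trK_inl_inl`), so only the SUM over the two leg orders is needed (road-P2 W-9 at (E); leaf-02 g64's (G7)(i)).  The
registered decision sentence of the OWNER's engine item E0 (`HOME/b2b-balaban-gan24-p1/gen51/E0-REQUEST.md` §2, filed 2026-08-27 as `R-GAN24P1-51-E0`) separates exactly these
two currencies (Dsym vs LS); this file puts the END on the weaker one in advance, so that outcome (ii) «(d′) too strong, (d) survives» needs no re-typing and outcome (i) is consumed
as is.  (d″) ⟸ (d′) trivially (add the two leg orders); NOT conversely.

WHAT (`T̃′♮_j := unitS₂_j (T2RecOf d Lc (GcombSh Lc) (SpureCombOf tabs cE cVH cΛ) tabs.M cE₂ cB Tc tabs.vh₂S tabs.mixFF j)`, `𝒜^K_j := lin4 (cE₂·Lc^{2(d+1)}) (unitK_j (KInvStep Lc j)) Lc`,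
`σ′_j := T̃′♮_{j+1} − 𝒜^K_j T̃′♮_j`, `LS_N (X)(κκ′;κ₁κ₂) := [zmode N X κ κ′ (inl κ₁) (inl κ₂) + zmode N X κ′ κ (inl κ₁) (inl κ₂)] + [zmode N X κ κ′ (inl κ₂) (inl κ₁) + zmode N X κ′ κ (inl κ₂) (inl κ₁)]`):
* §1 (generic `d`, ANY `tabs : SymTables d Lc`, every `N j`, NO pin) **`legBondSym_sourceB_comb_eq`** — `LS_N (σ′_j) = LS_N (T̃′♮_{j+1}) − N^{d+1}·(cE₂·Lc^{2(d+1)})·Lc^{−4(d+2)}·LS_Lc (T̃′♮_j)`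
  (the OWNER g50's `zmodeSym_sourceB_comb_eq` at the two leg orders, added); (pin `cE₂ = Lc^{d+5}`) **`legBondSymSource_comb_eq_zero_iff`** — `LS_Lc (σ′_l) = 0 ↔ LS_Lc (T̃′♮_{l+1}) = LS_Lc (T̃′♮_l)`.
* §2 (generic `d`) **`zsym_relSource_comb_even_of_legBondSym`** — the `hC` row of leaf-01 g83's END (the even member's relative source, `ε = 1`) at every level ⟸ «`∀ l, LS_Lc (σ′_l) = 0`»
  (leaf-01 g80's `CombRelSourceHalf.relSource_comb_half_eq` ⨾ leaf-02 g64's `zsym_halfTable_legSym` on leaf-01 g80's class `locStencil₂_relSource_comb`).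
* §3 (`d = 3`, `Lc` odd, `2 ≤ Lc`, `2 ≤ N`, an1's record `symTablesAn1S2 3 Lc cΛ`, locks `cΛ·Lc⁴ = 2`, `cB = −Lc¹²∕4`, the END's pins written in)
  **`exists_allScalesSeq_JsB12CombShSym_an1_of_sRows_legBondSymConserved`** — `∃ κ θ<1, AllScalesSeq (j ↦ secondMoment (TbalOf Lc (JsB12CombShSym hLc N (symTablesAn1S2 3 Lc cΛ) cΛ cB) j) μ ν) κ θ`
  ⟸ (b) the S-slot rows (hS, hSall) of `ScombOf` ∧ (d″) `∀ l κ κ′ κ₁ κ₂, LS_Lc (T̃′♮_{l+1}) = LS_Lc (T̃′♮_l)` — NOTHING ELSE; **`d1Drift_JsB12CombShSym_an1_iff_lim_eq_of_sRows_legBondSymConserved`** — row D1's reading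
  under the same two rows (the VALUE `lim β = stepBal Nc Lc` is row D1's and is NOT proved).
* (sibling module `GAN24/CombChargeConservationRowLegSymContact`, own file for the 400-line bound) the same END with (b) read from road-P2 g56's SIX S-slot CONTACT LETTERS
  (the OWNER g50's `CombChargeConservationRowContact` with (d′) weakened to (d″)).
WHAT THIS IS NOT.  (b) and (d″) are DISPLAYED; (d″) is NOT proved (its truth at the comb data at `l = 0` is the engine question E0, band «LS»); asserts NO value of Bałaban's tables and NO value of
any charge; NOT one S-∕W-slot row discharged as a VALUE; the (III′) campaign is NOT asked (an2 W-4) — zero weight; NEVER «G-an2-4 closed» as (CONV-C); NOT D1, NOT `BetaPertH`, NOT continuum,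
NOT Clay; not in print.  2026-08-27.
-/

noncomputable section

open Finset
open scoped BigOperators
open Literature.MathematicalPhysics.QuantumFieldTheory
open Literature.MathematicalPhysics.QuantumFieldTheory.Balaban1983to89
open Literature.MathematicalPhysics.QuantumFieldTheory.Balaban1983to89.Beta
open RemainderConstAllScales (AllScalesSeq)
open ExpKernelCalculus (MKer Decays shiftK)
open OneStepResolventKernel (Fib LocStencil decays_mono)
open OneStepKernelFamily (KInvStep decays_KInvStep TbalOf D1Drift)
open AffineAveraging (box toSite)
open BalabanCompositeJets (LocStencil₂ LocStencil₂.mono)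
open SecondOrderResponse (W2SymOfK)
open BalabanStepJetsSucc (mmRead)
open BalabanStepW2 (K3OfK M2Of)
open WilsonVertex2Sym (wsym22)
open Summit.QuantumFields.BalabanUV.Beta.TameKernelCalculus (trK)
open Summit.QuantumFields.BalabanUV.Beta.BorderedHessian (sgnK)
open Summit.QuantumFields.BalabanUV.Beta.HessKerDressedUnits (unitK unitS decays_unitK)
open Summit.QuantumFields.BalabanUV.Beta.SecondOrderUnits (unitM unitS₂ unitM₂)
open Summit.QuantumFields.BalabanUV.Beta.SpineRooted (T2RecOf T2RecAt T2RecOf_zero_level T2RecAt_zero_level)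
open WilsonBiStencil (wilsonW₂)
open Summit.QuantumFields.BalabanUV.Beta.SymmetrisedStepJets (SymTables)
open Summit.QuantumFields.BalabanUV.Beta.CombChartStepJets (GcombSh ScombOf SpureCombOf)
open Summit.QuantumFields.BalabanUV.Beta.CombChartJointEnd (JsB12CombShSym)
open Summit.QuantumFields.BalabanUV.Beta.SymSecondOrderTablesAn1 (symTablesAn1S2)
open Summit.QuantumFields.BalabanUV.Beta.GAN24.CombesThomas (sfStep smStep)
open Summit.QuantumFields.BalabanUV.Beta.GAN24.T2RecursionAffine (lin4)
open Summit.QuantumFields.BalabanUV.Beta.GAN24.BiStencilZeroMode (Tab zmode)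
open Summit.QuantumFields.BalabanUV.Beta.GAN24.WSlotFirstDiff (zmode_sub)
open Summit.QuantumFields.BalabanUV.Beta.GAN24.Lin4ZeroMode (locStencil₂_lin4 zmode_lin4_step)
open Summit.QuantumFields.BalabanUV.Beta.GAN24.T2RecChargeLedger (charge_factor_eq_one_of_pinEq)
open Summit.QuantumFields.BalabanUV.Beta.GAN24.T2RecChargeStep (zmode_member_zero)
open Summit.QuantumFields.BalabanUV.Beta.GAN24.CombRelSourceHalfCharge (locStencil₂_unitS₂_T2RecOf_comb zsym_relSource_comb_half)
open Summit.QuantumFields.BalabanUV.Beta.GAN24.CombT2DriftEvenEnd (unitS₂_T2RecOf_comb_translate)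
open Summit.QuantumFields.BalabanUV.Beta.GAN24.CombTowerEndAtPin (exists_allScalesSeq_JsB12CombShSym_an1_of_sRows_at_pin d1Drift_JsB12CombShSym_an1_iff_lim_eq_of_sRows_at_pin)
open ExpKernelCalculus (MKer comp)
open OneStepResolventKernel (Fib LocStencil)
open OneStepKernelFamily (KInvStep TbalOf D1Drift)
open KernelWard (divV)
open AffineAveraging (box toSite unitVec Site)
open AveragingContoursRooted (ctr ctrOff ctrOff_mem_box)
open BalabanCompositeJets (LocStencil₂ respStep)
open B4ContourShift (supNorm)
open StepJetData (wilsonA)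
open Summit.QuantumFields.BalabanUV.Beta.BorderedHessian (sgnK diagK)
open Summit.QuantumFields.BalabanUV.Beta.AveragingWardRootedStencils (legInd)
open Summit.QuantumFields.BalabanUV.Beta.HessKerDressedUnits (unitK unitS)
open Summit.QuantumFields.BalabanUV.Beta.SpineRooted (T2RecOf)
open Summit.QuantumFields.BalabanUV.Beta.SymCorrectorKernel (psiKS)
open Summit.QuantumFields.BalabanUV.Beta.SymAveragingHessianCounts (symHessFFAt symVhSAt)
open Summit.QuantumFields.BalabanUV.Beta.GAN24.CombesThomas (sfStep smStep KStepUnit SupBound)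
open Summit.QuantumFields.BalabanUV.Beta.GAN24.BiStencilZeroMode (zmode)
open Summit.QuantumFields.BalabanUV.Beta.GAN24.Push4 (legComp IsFF)
open Summit.QuantumFields.BalabanUV.Beta.GAN24.Push4Iter (legChain)
open Summit.QuantumFields.BalabanUV.Beta.GAN24.Push3 (push₃)
open Summit.QuantumFields.BalabanUV.Beta.GAN24.AffineUnroll (transport)
open Summit.QuantumFields.BalabanUV.Beta.GAN24.SrecLinearPartEq (colM rowMM reslot)
open Summit.QuantumFields.BalabanUV.Beta.GAN24.RespStepBmDecompExact (respStepBmSeq)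
open Summit.QuantumFields.BalabanUV.Beta.GAN24.CombBornSector (combFreshAt combUnitStepMap)
open Summit.QuantumFields.BalabanUV.Beta.GAN24.CombRelSourceHalfCharge (zsym_relSource_comb_half)
open Summit.QuantumFields.BalabanUV.Beta.GAN24.CombTowerEndAtPin (exists_allScalesSeq_JsB12CombShSym_an1_of_contactLetters_at_pin)
open Summit.QuantumFields.BalabanUV.Beta.GAN24.CombChargeConservationRow (zsymMember_comb_succ_eq_iff_rowC)
open Summit.QuantumFields.BalabanUV.Beta.GAN24.RowCChargeFormsLegSym (zsym_halfTable_legSym)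
open Summit.QuantumFields.BalabanUV.Beta.GAN24.CombRelSourceHalf (relSource_comb_half_eq)
open Summit.QuantumFields.BalabanUV.Beta.GAN24.CombRelSourceHalfCharge (locStencil₂_relSource_comb)
open Summit.QuantumFields.BalabanUV.Beta.GAN24.CombChargeConservationRow (zmodeSym_sourceB_comb_eq)
open Summit.QuantumFields.BalabanUV.Beta.GAN24.CombTowerEndAtPin (exists_allScalesSeq_JsB12CombShSym_an1_of_sRows_at_pin d1Drift_JsB12CombShSym_an1_iff_lim_eq_of_sRows_at_pin exists_allScalesSeq_JsB12CombShSym_an1_of_contactLetters_at_pin)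

namespace Summit.QuantumFields.BalabanUV.Beta.GAN24.CombChargeConservationRowLegSym

variable {d : ℕ} {Lc : ℕ} [NeZero Lc]

/-! ## §1 The leg-and-bond-symmetrised charge of the comb-chart B-frame source (generic `d`, any sym record, no pin) -/

/-- NOT IN PRINT; OUR BOOKKEEPING ([folklore]; the OWNER g50's `zmodeSym_sourceB_comb_eq` at the leg orders `(α,β)` and `(β,α)`, added).  **THE LEG-AND-BOND-SYMMETRISED CHARGE OF THE
COMB-CHART B-FRAME SOURCE** `σ′_j := T̃′♮_{j+1} − 𝒜^K_j T̃′♮_j`: `LS_N (σ′_j) = LS_N (T̃′♮_{j+1}) − N^{d+1}·(cE₂·Lc^{2(d+1)})·Lc^{−4(d+2)}·LS_Lc (T̃′♮_j)` — every `j`, every `N`, any record, NO pin. -/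
theorem legBondSym_sourceB_comb_eq (tabs : SymTables d Lc) (cE cVH cΛ cE₂ cB : ℝ) (Tc : Fin 4 → Fin 4 → Fin 4 → Fin 4 → ℝ)
    (N j : ℕ) (μ ν α β : Fin (d + 1)) :
    (zmode N (fun κ u κ' u' =>
          unitS₂ (sfStep Lc (j + 1)) (smStep d Lc (j + 1)) (T2RecOf d Lc (GcombSh Lc) (SpureCombOf tabs cE cVH cΛ) tabs.M cE₂ cB Tc tabs.vh₂S tabs.mixFF (j + 1)) κ u κ' u'
        - lin4 (cE₂ * (Lc : ℝ) ^ (2 * (d + 1))) (unitK (sfStep Lc j) (smStep d Lc j) (KInvStep (d := d) Lc j)) Lc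
            (unitS₂ (sfStep Lc j) (smStep d Lc j) (T2RecOf d Lc (GcombSh Lc) (SpureCombOf tabs cE cVH cΛ) tabs.M cE₂ cB Tc tabs.vh₂S tabs.mixFF j)) κ u κ' u') μ ν (Sum.inl α) (Sum.inl β)
      + zmode N (fun κ u κ' u' =>
          unitS₂ (sfStep Lc (j + 1)) (smStep d Lc (j + 1)) (T2RecOf d Lc (GcombSh Lc) (SpureCombOf tabs cE cVH cΛ) tabs.M cE₂ cB Tc tabs.vh₂S tabs.mixFF (j + 1)) κ u κ' u'
        - lin4 (cE₂ * (Lc : ℝ) ^ (2 * (d + 1))) (unitK (sfStep Lc j) (smStep d Lc j) (KInvStep (d := d) Lc j)) Lc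
            (unitS₂ (sfStep Lc j) (smStep d Lc j) (T2RecOf d Lc (GcombSh Lc) (SpureCombOf tabs cE cVH cΛ) tabs.M cE₂ cB Tc tabs.vh₂S tabs.mixFF j)) κ u κ' u') ν μ (Sum.inl α) (Sum.inl β))
    + (zmode N (fun κ u κ' u' =>
          unitS₂ (sfStep Lc (j + 1)) (smStep d Lc (j + 1)) (T2RecOf d Lc (GcombSh Lc) (SpureCombOf tabs cE cVH cΛ) tabs.M cE₂ cB Tc tabs.vh₂S tabs.mixFF (j + 1)) κ u κ' u'
        - lin4 (cE₂ * (Lc : ℝ) ^ (2 * (d + 1))) (unitK (sfStep Lc j) (smStep d Lc j) (KInvStep (d := d) Lc j)) Lc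
            (unitS₂ (sfStep Lc j) (smStep d Lc j) (T2RecOf d Lc (GcombSh Lc) (SpureCombOf tabs cE cVH cΛ) tabs.M cE₂ cB Tc tabs.vh₂S tabs.mixFF j)) κ u κ' u') μ ν (Sum.inl β) (Sum.inl α)
      + zmode N (fun κ u κ' u' =>
          unitS₂ (sfStep Lc (j + 1)) (smStep d Lc (j + 1)) (T2RecOf d Lc (GcombSh Lc) (SpureCombOf tabs cE cVH cΛ) tabs.M cE₂ cB Tc tabs.vh₂S tabs.mixFF (j + 1)) κ u κ' u'
        - lin4 (cE₂ * (Lc : ℝ) ^ (2 * (d + 1))) (unitK (sfStep Lc j) (smStep d Lc j) (KInvStep (d := d) Lc j)) Lc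
            (unitS₂ (sfStep Lc j) (smStep d Lc j) (T2RecOf d Lc (GcombSh Lc) (SpureCombOf tabs cE cVH cΛ) tabs.M cE₂ cB Tc tabs.vh₂S tabs.mixFF j)) κ u κ' u') ν μ (Sum.inl β) (Sum.inl α))
      = ((zmode N (unitS₂ (sfStep Lc (j + 1)) (smStep d Lc (j + 1)) (T2RecOf d Lc (GcombSh Lc) (SpureCombOf tabs cE cVH cΛ) tabs.M cE₂ cB Tc tabs.vh₂S tabs.mixFF (j + 1))) μ ν (Sum.inl α) (Sum.inl β)
            + zmode N (unitS₂ (sfStep Lc (j + 1)) (smStep d Lc (j + 1)) (T2RecOf d Lc (GcombSh Lc) (SpureCombOf tabs cE cVH cΛ) tabs.M cE₂ cB Tc tabs.vh₂S tabs.mixFF (j + 1))) ν μ (Sum.inl α) (Sum.inl β))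
          + (zmode N (unitS₂ (sfStep Lc (j + 1)) (smStep d Lc (j + 1)) (T2RecOf d Lc (GcombSh Lc) (SpureCombOf tabs cE cVH cΛ) tabs.M cE₂ cB Tc tabs.vh₂S tabs.mixFF (j + 1))) μ ν (Sum.inl β) (Sum.inl α)
            + zmode N (unitS₂ (sfStep Lc (j + 1)) (smStep d Lc (j + 1)) (T2RecOf d Lc (GcombSh Lc) (SpureCombOf tabs cE cVH cΛ) tabs.M cE₂ cB Tc tabs.vh₂S tabs.mixFF (j + 1))) ν μ (Sum.inl β) (Sum.inl α)))
        - ((N : ℝ) ^ (d + 1)) * ((cE₂ * (Lc : ℝ) ^ (2 * (d + 1))) * (((Lc : ℝ) ^ (d + 1 + 1))⁻¹) ^ 4) *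
          ((zmode Lc (unitS₂ (sfStep Lc j) (smStep d Lc j) (T2RecOf d Lc (GcombSh Lc) (SpureCombOf tabs cE cVH cΛ) tabs.M cE₂ cB Tc tabs.vh₂S tabs.mixFF j)) μ ν (Sum.inl α) (Sum.inl β)
              + zmode Lc (unitS₂ (sfStep Lc j) (smStep d Lc j) (T2RecOf d Lc (GcombSh Lc) (SpureCombOf tabs cE cVH cΛ) tabs.M cE₂ cB Tc tabs.vh₂S tabs.mixFF j)) ν μ (Sum.inl α) (Sum.inl β))
            + (zmode Lc (unitS₂ (sfStep Lc j) (smStep d Lc j) (T2RecOf d Lc (GcombSh Lc) (SpureCombOf tabs cE cVH cΛ) tabs.M cE₂ cB Tc tabs.vh₂S tabs.mixFF j)) μ ν (Sum.inl β) (Sum.inl α)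
              + zmode Lc (unitS₂ (sfStep Lc j) (smStep d Lc j) (T2RecOf d Lc (GcombSh Lc) (SpureCombOf tabs cE cVH cΛ) tabs.M cE₂ cB Tc tabs.vh₂S tabs.mixFF j)) ν μ (Sum.inl β) (Sum.inl α))) := by
  have h1 := zmodeSym_sourceB_comb_eq tabs cE cVH cΛ cE₂ cB Tc N j μ ν α β
  have h2 := zmodeSym_sourceB_comb_eq tabs cE cVH cΛ cE₂ cB Tc N j μ ν β α
  rw [h1, h2]
  ring

/-- NOT IN PRINT; OUR BOOKKEEPING.  **THE LEG-AND-BOND-SYMMETRISED CONSERVATION CRITERION AT THE COMB DATA** (pin `cE₂ = Lc^{d+5}`, `N := Lc`, charge factor `1` by gan24-p2's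
`T2RecChargeLedger.charge_factor_eq_one_of_pinEq`; `Pi`-difference spelling of the source, the pointwise one by `rfl`): `LS_Lc (σ′_l) = 0 ↔ LS_Lc (T̃′♮_{l+1}) = LS_Lc (T̃′♮_l)`. -/
theorem legBondSymSource_comb_eq_zero_iff (tabs : SymTables d Lc) (cE cVH cΛ cE₂ cB : ℝ) (Tc : Fin 4 → Fin 4 → Fin 4 → Fin 4 → ℝ)
    (hpinEq : cE₂ = (Lc : ℝ) ^ (d + 5)) (l : ℕ) (κ κ' κ₁ κ₂ : Fin (d + 1)) :
    (zmode Lc ((unitS₂ (sfStep Lc (l + 1)) (smStep d Lc (l + 1)) (T2RecOf d Lc (GcombSh Lc) (SpureCombOf tabs cE cVH cΛ) tabs.M cE₂ cB Tc tabs.vh₂S tabs.mixFF (l + 1)))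
            - lin4 (cE₂ * (Lc : ℝ) ^ (2 * (d + 1))) (unitK (sfStep Lc l) (smStep d Lc l) (KInvStep (d := d) Lc l)) Lc
              (unitS₂ (sfStep Lc l) (smStep d Lc l) (T2RecOf d Lc (GcombSh Lc) (SpureCombOf tabs cE cVH cΛ) tabs.M cE₂ cB Tc tabs.vh₂S tabs.mixFF l))) κ κ' (Sum.inl κ₁) (Sum.inl κ₂)
        + zmode Lc ((unitS₂ (sfStep Lc (l + 1)) (smStep d Lc (l + 1)) (T2RecOf d Lc (GcombSh Lc) (SpureCombOf tabs cE cVH cΛ) tabs.M cE₂ cB Tc tabs.vh₂S tabs.mixFF (l + 1)))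
            - lin4 (cE₂ * (Lc : ℝ) ^ (2 * (d + 1))) (unitK (sfStep Lc l) (smStep d Lc l) (KInvStep (d := d) Lc l)) Lc
              (unitS₂ (sfStep Lc l) (smStep d Lc l) (T2RecOf d Lc (GcombSh Lc) (SpureCombOf tabs cE cVH cΛ) tabs.M cE₂ cB Tc tabs.vh₂S tabs.mixFF l))) κ' κ (Sum.inl κ₁) (Sum.inl κ₂))
      + (zmode Lc ((unitS₂ (sfStep Lc (l + 1)) (smStep d Lc (l + 1)) (T2RecOf d Lc (GcombSh Lc) (SpureCombOf tabs cE cVH cΛ) tabs.M cE₂ cB Tc tabs.vh₂S tabs.mixFF (l + 1)))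
            - lin4 (cE₂ * (Lc : ℝ) ^ (2 * (d + 1))) (unitK (sfStep Lc l) (smStep d Lc l) (KInvStep (d := d) Lc l)) Lc
              (unitS₂ (sfStep Lc l) (smStep d Lc l) (T2RecOf d Lc (GcombSh Lc) (SpureCombOf tabs cE cVH cΛ) tabs.M cE₂ cB Tc tabs.vh₂S tabs.mixFF l))) κ κ' (Sum.inl κ₂) (Sum.inl κ₁)
        + zmode Lc ((unitS₂ (sfStep Lc (l + 1)) (smStep d Lc (l + 1)) (T2RecOf d Lc (GcombSh Lc) (SpureCombOf tabs cE cVH cΛ) tabs.M cE₂ cB Tc tabs.vh₂S tabs.mixFF (l + 1)))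
            - lin4 (cE₂ * (Lc : ℝ) ^ (2 * (d + 1))) (unitK (sfStep Lc l) (smStep d Lc l) (KInvStep (d := d) Lc l)) Lc
              (unitS₂ (sfStep Lc l) (smStep d Lc l) (T2RecOf d Lc (GcombSh Lc) (SpureCombOf tabs cE cVH cΛ) tabs.M cE₂ cB Tc tabs.vh₂S tabs.mixFF l))) κ' κ (Sum.inl κ₂) (Sum.inl κ₁)) = 0
      ↔ (zmode Lc (unitS₂ (sfStep Lc (l + 1)) (smStep d Lc (l + 1)) (T2RecOf d Lc (GcombSh Lc) (SpureCombOf tabs cE cVH cΛ) tabs.M cE₂ cB Tc tabs.vh₂S tabs.mixFF (l + 1))) κ κ' (Sum.inl κ₁) (Sum.inl κ₂)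
          + zmode Lc (unitS₂ (sfStep Lc (l + 1)) (smStep d Lc (l + 1)) (T2RecOf d Lc (GcombSh Lc) (SpureCombOf tabs cE cVH cΛ) tabs.M cE₂ cB Tc tabs.vh₂S tabs.mixFF (l + 1))) κ' κ (Sum.inl κ₁) (Sum.inl κ₂))
        + (zmode Lc (unitS₂ (sfStep Lc (l + 1)) (smStep d Lc (l + 1)) (T2RecOf d Lc (GcombSh Lc) (SpureCombOf tabs cE cVH cΛ) tabs.M cE₂ cB Tc tabs.vh₂S tabs.mixFF (l + 1))) κ κ' (Sum.inl κ₂) (Sum.inl κ₁)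
          + zmode Lc (unitS₂ (sfStep Lc (l + 1)) (smStep d Lc (l + 1)) (T2RecOf d Lc (GcombSh Lc) (SpureCombOf tabs cE cVH cΛ) tabs.M cE₂ cB Tc tabs.vh₂S tabs.mixFF (l + 1))) κ' κ (Sum.inl κ₂) (Sum.inl κ₁))
        = (zmode Lc (unitS₂ (sfStep Lc l) (smStep d Lc l) (T2RecOf d Lc (GcombSh Lc) (SpureCombOf tabs cE cVH cΛ) tabs.M cE₂ cB Tc tabs.vh₂S tabs.mixFF l)) κ κ' (Sum.inl κ₁) (Sum.inl κ₂)
            + zmode Lc (unitS₂ (sfStep Lc l) (smStep d Lc l) (T2RecOf d Lc (GcombSh Lc) (SpureCombOf tabs cE cVH cΛ) tabs.M cE₂ cB Tc tabs.vh₂S tabs.mixFF l)) κ' κ (Sum.inl κ₁) (Sum.inl κ₂))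
          + (zmode Lc (unitS₂ (sfStep Lc l) (smStep d Lc l) (T2RecOf d Lc (GcombSh Lc) (SpureCombOf tabs cE cVH cΛ) tabs.M cE₂ cB Tc tabs.vh₂S tabs.mixFF l)) κ κ' (Sum.inl κ₂) (Sum.inl κ₁)
            + zmode Lc (unitS₂ (sfStep Lc l) (smStep d Lc l) (T2RecOf d Lc (GcombSh Lc) (SpureCombOf tabs cE cVH cΛ) tabs.M cE₂ cB Tc tabs.vh₂S tabs.mixFF l)) κ' κ (Sum.inl κ₂) (Sum.inl κ₁)) := by
  have h := legBondSym_sourceB_comb_eq tabs cE cVH cΛ cE₂ cB Tc Lc l κ κ' κ₁ κ₂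
  rw [charge_factor_eq_one_of_pinEq (d := d) (Lc := Lc) hpinEq, one_mul] at h
  rw [← sub_eq_zero (a := (zmode Lc (unitS₂ (sfStep Lc (l + 1)) (smStep d Lc (l + 1)) (T2RecOf d Lc (GcombSh Lc) (SpureCombOf tabs cE cVH cΛ) tabs.M cE₂ cB Tc tabs.vh₂S tabs.mixFF (l + 1))) κ κ' (Sum.inl κ₁) (Sum.inl κ₂)
            + zmode Lc (unitS₂ (sfStep Lc (l + 1)) (smStep d Lc (l + 1)) (T2RecOf d Lc (GcombSh Lc) (SpureCombOf tabs cE cVH cΛ) tabs.M cE₂ cB Tc tabs.vh₂S tabs.mixFF (l + 1))) κ' κ (Sum.inl κ₁) (Sum.inl κ₂))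
          + (zmode Lc (unitS₂ (sfStep Lc (l + 1)) (smStep d Lc (l + 1)) (T2RecOf d Lc (GcombSh Lc) (SpureCombOf tabs cE cVH cΛ) tabs.M cE₂ cB Tc tabs.vh₂S tabs.mixFF (l + 1))) κ κ' (Sum.inl κ₂) (Sum.inl κ₁)
            + zmode Lc (unitS₂ (sfStep Lc (l + 1)) (smStep d Lc (l + 1)) (T2RecOf d Lc (GcombSh Lc) (SpureCombOf tabs cE cVH cΛ) tabs.M cE₂ cB Tc tabs.vh₂S tabs.mixFF (l + 1))) κ' κ (Sum.inl κ₂) (Sum.inl κ₁))), ← h]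
  exact Iff.rfl

/-! ## §2 The END's `hC` (even member's relative source, `ε = 1`) from the leg-and-bond-symmetrised row (generic `d`) -/

/-- NOT IN PRINT; OUR BOOKKEEPING.  **THE END's `hC` FROM THE LEG-AND-BOND-SYMMETRISED ROW**: if at every level the comb-chart B-frame source `σ′_l` has vanishing LEG-AND-BOND-SYMMETRISED
ff cell charge at period `Lc`, then the EVEN member's relative source `½ • (b̃′♮_l + P b̃′♮_l) + (𝒜^{G′}_l y_l − 𝒜^K_l y_l)` (`y_l` the even member, `P = sgnK ∘ trK`, `ε = 1`) is bond-symmetrised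
ff zero-mode-free — leaf-01 g80's `CombRelSourceHalf.relSource_comb_half_eq` rewrites it as `½ • (σ′_l + 1 • P σ′_l)`, leaf-02 g64's `RowCChargeFormsLegSym.zsym_halfTable_legSym` passes the
leg-symmetrised row to the even half (class: leaf-01 g80's `locStencil₂_relSource_comb`).  The conclusion is leaf-01 g80's `zsym_relSource_comb_half` at `ε = 1`, token for token. -/
theorem zsym_relSource_comb_even_of_legBondSym (tabs : SymTables d Lc) (cE cVH cΛ cE₂ cB : ℝ) (Tc : Fin 4 → Fin 4 → Fin 4 → Fin 4 → ℝ)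
    (hBff : ∀ κ u κ' u' x z (α β : Fin (d + 1)), tabs.vh₂S κ u κ' u' x z (Sum.inl α) (Sum.inl β) = 0)
    (hBmm : ∀ κ u κ' u' x z (μ ν : Fin (d + 1)), tabs.vh₂S κ u κ' u' x z (Sum.inr μ) (Sum.inr ν) = 0)
    (hC2 : ∀ (l : ℕ) (κ κ' κ₁ κ₂ : Fin (d + 1)),
      (zmode Lc ((unitS₂ (sfStep Lc (l + 1)) (smStep d Lc (l + 1)) (T2RecOf d Lc (GcombSh Lc) (SpureCombOf tabs cE cVH cΛ) tabs.M cE₂ cB Tc tabs.vh₂S tabs.mixFF (l + 1)))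
            - lin4 (cE₂ * (Lc : ℝ) ^ (2 * (d + 1))) (unitK (sfStep Lc l) (smStep d Lc l) (KInvStep (d := d) Lc l)) Lc
              (unitS₂ (sfStep Lc l) (smStep d Lc l) (T2RecOf d Lc (GcombSh Lc) (SpureCombOf tabs cE cVH cΛ) tabs.M cE₂ cB Tc tabs.vh₂S tabs.mixFF l))) κ κ' (Sum.inl κ₁) (Sum.inl κ₂)
        + zmode Lc ((unitS₂ (sfStep Lc (l + 1)) (smStep d Lc (l + 1)) (T2RecOf d Lc (GcombSh Lc) (SpureCombOf tabs cE cVH cΛ) tabs.M cE₂ cB Tc tabs.vh₂S tabs.mixFF (l + 1)))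
            - lin4 (cE₂ * (Lc : ℝ) ^ (2 * (d + 1))) (unitK (sfStep Lc l) (smStep d Lc l) (KInvStep (d := d) Lc l)) Lc
              (unitS₂ (sfStep Lc l) (smStep d Lc l) (T2RecOf d Lc (GcombSh Lc) (SpureCombOf tabs cE cVH cΛ) tabs.M cE₂ cB Tc tabs.vh₂S tabs.mixFF l))) κ' κ (Sum.inl κ₁) (Sum.inl κ₂))
      + (zmode Lc ((unitS₂ (sfStep Lc (l + 1)) (smStep d Lc (l + 1)) (T2RecOf d Lc (GcombSh Lc) (SpureCombOf tabs cE cVH cΛ) tabs.M cE₂ cB Tc tabs.vh₂S tabs.mixFF (l + 1)))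
            - lin4 (cE₂ * (Lc : ℝ) ^ (2 * (d + 1))) (unitK (sfStep Lc l) (smStep d Lc l) (KInvStep (d := d) Lc l)) Lc
              (unitS₂ (sfStep Lc l) (smStep d Lc l) (T2RecOf d Lc (GcombSh Lc) (SpureCombOf tabs cE cVH cΛ) tabs.M cE₂ cB Tc tabs.vh₂S tabs.mixFF l))) κ κ' (Sum.inl κ₂) (Sum.inl κ₁)
        + zmode Lc ((unitS₂ (sfStep Lc (l + 1)) (smStep d Lc (l + 1)) (T2RecOf d Lc (GcombSh Lc) (SpureCombOf tabs cE cVH cΛ) tabs.M cE₂ cB Tc tabs.vh₂S tabs.mixFF (l + 1)))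
            - lin4 (cE₂ * (Lc : ℝ) ^ (2 * (d + 1))) (unitK (sfStep Lc l) (smStep d Lc l) (KInvStep (d := d) Lc l)) Lc
              (unitS₂ (sfStep Lc l) (smStep d Lc l) (T2RecOf d Lc (GcombSh Lc) (SpureCombOf tabs cE cVH cΛ) tabs.M cE₂ cB Tc tabs.vh₂S tabs.mixFF l))) κ' κ (Sum.inl κ₂) (Sum.inl κ₁)) = 0)
    (l : ℕ) (κ κ' κ₁ κ₂ : Fin (d + 1)) :
    zmode Lc (((1 / 2 : ℝ) • ((fun κ u κ' u' => (cE₂ * (Lc : ℝ) ^ (2 * (d + 1))) • mmRead Lc (K3OfK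
            (unitK (sfStep Lc l) (smStep d Lc l) (GcombSh (d := d) Lc l)) Lc
            (unitS (sfStep Lc l) (smStep d Lc l) (SpureCombOf tabs cE cVH cΛ l)) (unitM (sfStep Lc l) (smStep d Lc l) (tabs.M l))
            (W2SymOfK (unitK (sfStep Lc l) (smStep d Lc l) (GcombSh (d := d) Lc l)) Lc
              (unitS (sfStep Lc l) (smStep d Lc l) (SpureCombOf tabs cE cVH cΛ l)) (unitM (sfStep Lc l) (smStep d Lc l) (tabs.M l)) 0
              (unitM₂ (sfStep Lc l) (smStep d Lc l) (M2Of d Lc tabs.mixFF l))) κ u κ' u') + cB • tabs.vh₂S κ u κ' u')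
          + (1 : ℝ) • fun κ u κ' u' => sgnK (trK ((fun κ u κ' u' => (cE₂ * (Lc : ℝ) ^ (2 * (d + 1))) • mmRead Lc (K3OfK
            (unitK (sfStep Lc l) (smStep d Lc l) (GcombSh (d := d) Lc l)) Lc
            (unitS (sfStep Lc l) (smStep d Lc l) (SpureCombOf tabs cE cVH cΛ l)) (unitM (sfStep Lc l) (smStep d Lc l) (tabs.M l))
            (W2SymOfK (unitK (sfStep Lc l) (smStep d Lc l) (GcombSh (d := d) Lc l)) Lc
              (unitS (sfStep Lc l) (smStep d Lc l) (SpureCombOf tabs cE cVH cΛ l)) (unitM (sfStep Lc l) (smStep d Lc l) (tabs.M l)) 0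
              (unitM₂ (sfStep Lc l) (smStep d Lc l) (M2Of d Lc tabs.mixFF l))) κ u κ' u') + cB • tabs.vh₂S κ u κ' u') κ u κ' u'))))
        + (lin4 (cE₂ * (Lc : ℝ) ^ (2 * (d + 1))) (unitK (sfStep Lc l) (smStep d Lc l) (GcombSh (d := d) Lc l)) Lc
              ((1 / 2 : ℝ) • (unitS₂ (sfStep Lc l) (smStep d Lc l) (T2RecOf d Lc (GcombSh Lc) (SpureCombOf tabs cE cVH cΛ) tabs.M cE₂ cB Tc tabs.vh₂S tabs.mixFF l)
          + (1 : ℝ) • fun κ u κ' u' => sgnK (trK (unitS₂ (sfStep Lc l) (smStep d Lc l) (T2RecOf d Lc (GcombSh Lc) (SpureCombOf tabs cE cVH cΛ) tabs.M cE₂ cB Tc tabs.vh₂S tabs.mixFF l) κ u κ' u'))))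
          - lin4 (cE₂ * (Lc : ℝ) ^ (2 * (d + 1))) (unitK (sfStep Lc l) (smStep d Lc l) (KInvStep (d := d) Lc l)) Lc
              ((1 / 2 : ℝ) • (unitS₂ (sfStep Lc l) (smStep d Lc l) (T2RecOf d Lc (GcombSh Lc) (SpureCombOf tabs cE cVH cΛ) tabs.M cE₂ cB Tc tabs.vh₂S tabs.mixFF l)
          + (1 : ℝ) • fun κ u κ' u' => sgnK (trK (unitS₂ (sfStep Lc l) (smStep d Lc l) (T2RecOf d Lc (GcombSh Lc) (SpureCombOf tabs cE cVH cΛ) tabs.M cE₂ cB Tc tabs.vh₂S tabs.mixFF l) κ u κ' u')))))) κ κ' (Sum.inl κ₁) (Sum.inl κ₂)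
      + zmode Lc (((1 / 2 : ℝ) • ((fun κ u κ' u' => (cE₂ * (Lc : ℝ) ^ (2 * (d + 1))) • mmRead Lc (K3OfK
            (unitK (sfStep Lc l) (smStep d Lc l) (GcombSh (d := d) Lc l)) Lc
            (unitS (sfStep Lc l) (smStep d Lc l) (SpureCombOf tabs cE cVH cΛ l)) (unitM (sfStep Lc l) (smStep d Lc l) (tabs.M l))
            (W2SymOfK (unitK (sfStep Lc l) (smStep d Lc l) (GcombSh (d := d) Lc l)) Lc
              (unitS (sfStep Lc l) (smStep d Lc l) (SpureCombOf tabs cE cVH cΛ l)) (unitM (sfStep Lc l) (smStep d Lc l) (tabs.M l)) 0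
              (unitM₂ (sfStep Lc l) (smStep d Lc l) (M2Of d Lc tabs.mixFF l))) κ u κ' u') + cB • tabs.vh₂S κ u κ' u')
          + (1 : ℝ) • fun κ u κ' u' => sgnK (trK ((fun κ u κ' u' => (cE₂ * (Lc : ℝ) ^ (2 * (d + 1))) • mmRead Lc (K3OfK
            (unitK (sfStep Lc l) (smStep d Lc l) (GcombSh (d := d) Lc l)) Lc
            (unitS (sfStep Lc l) (smStep d Lc l) (SpureCombOf tabs cE cVH cΛ l)) (unitM (sfStep Lc l) (smStep d Lc l) (tabs.M l))
            (W2SymOfK (unitK (sfStep Lc l) (smStep d Lc l) (GcombSh (d := d) Lc l)) Lc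
              (unitS (sfStep Lc l) (smStep d Lc l) (SpureCombOf tabs cE cVH cΛ l)) (unitM (sfStep Lc l) (smStep d Lc l) (tabs.M l)) 0
              (unitM₂ (sfStep Lc l) (smStep d Lc l) (M2Of d Lc tabs.mixFF l))) κ u κ' u') + cB • tabs.vh₂S κ u κ' u') κ u κ' u'))))
        + (lin4 (cE₂ * (Lc : ℝ) ^ (2 * (d + 1))) (unitK (sfStep Lc l) (smStep d Lc l) (GcombSh (d := d) Lc l)) Lc
              ((1 / 2 : ℝ) • (unitS₂ (sfStep Lc l) (smStep d Lc l) (T2RecOf d Lc (GcombSh Lc) (SpureCombOf tabs cE cVH cΛ) tabs.M cE₂ cB Tc tabs.vh₂S tabs.mixFF l)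
          + (1 : ℝ) • fun κ u κ' u' => sgnK (trK (unitS₂ (sfStep Lc l) (smStep d Lc l) (T2RecOf d Lc (GcombSh Lc) (SpureCombOf tabs cE cVH cΛ) tabs.M cE₂ cB Tc tabs.vh₂S tabs.mixFF l) κ u κ' u'))))
          - lin4 (cE₂ * (Lc : ℝ) ^ (2 * (d + 1))) (unitK (sfStep Lc l) (smStep d Lc l) (KInvStep (d := d) Lc l)) Lc
              ((1 / 2 : ℝ) • (unitS₂ (sfStep Lc l) (smStep d Lc l) (T2RecOf d Lc (GcombSh Lc) (SpureCombOf tabs cE cVH cΛ) tabs.M cE₂ cB Tc tabs.vh₂S tabs.mixFF l)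
          + (1 : ℝ) • fun κ u κ' u' => sgnK (trK (unitS₂ (sfStep Lc l) (smStep d Lc l) (T2RecOf d Lc (GcombSh Lc) (SpureCombOf tabs cE cVH cΛ) tabs.M cE₂ cB Tc tabs.vh₂S tabs.mixFF l) κ u κ' u')))))) κ' κ (Sum.inl κ₁) (Sum.inl κ₂) = 0 := by
  obtain ⟨C, δ, hδ, hrel⟩ := locStencil₂_relSource_comb tabs cE cVH cΛ cE₂ cB Tc l
  rw [relSource_comb_half_eq tabs cE cVH cΛ cE₂ cB Tc hBff hBmm (1 : ℝ) l]
  exact zsym_halfTable_legSym hrel hδ (hC2 l) (1 / 2 : ℝ) κ κ' κ₁ κ₂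

/-! ## §3 `d = 3`, an1's record: the (III′) END with the (C)^{ev} row in its weakest conservation currency -/

/-- NOT IN PRINT; OUR BOOKKEEPING.  **THE G-an2-4 END AT ROW D1's LITERAL OF RECORD (III′) FROM (b) THE S-SLOT ROWS OF `ScombOf` AND (d″) ONE-STEP CONSERVATION OF THE
LEG-AND-BOND-SYMMETRISED ff ZERO-MODE CHARGE ALONG THE COMB-CHART `T₂` TOWER — NOTHING ELSE** (leaf-01 g83's `CombTowerEndAtPin.exists_allScalesSeq_JsB12CombShSym_an1_of_sRows_at_pin` with its
`hC` supplied from (d″) by §1 `legBondSymSource_comb_eq_zero_iff` ⨾ §2 `zsym_relSource_comb_even_of_legBondSym` ⨾ `one_smul`; the pin `Lc⁸ = Lc^{3+5}` by `norm_num`, the record's border ff ∕ mm blocks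
`rfl`).  Rows (b) and (d″) DISPLAYED; (d″) ⟸ the OWNER g50's (d′) (add the two leg orders), not conversely. -/
theorem exists_allScalesSeq_JsB12CombShSym_an1_of_sRows_legBondSymConserved (hLc : Odd Lc) (hLc2 : 2 ≤ Lc) {N : ℕ} (hN : 2 ≤ N) {cΛ cB : ℝ} (hΛ : cΛ * (Lc : ℝ) ^ 4 = 2) (hcB : cB = -((Lc : ℝ) ^ 12 / 4))
    {Cs cS θS δS : ℝ}
    (hS : ∀ j, LocStencil (unitS (sfStep Lc j) (smStep 3 Lc j) (ScombOf (symTablesAn1S2 3 Lc cΛ) ((Lc : ℝ) ^ 4) (-((Lc : ℝ) ^ 8 / 2)) cΛ j)) Cs δS)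
    (hSall : ∀ k j, LocStencil (unitS (sfStep Lc (k + j)) (smStep 3 Lc (k + j)) (ScombOf (symTablesAn1S2 3 Lc cΛ) ((Lc : ℝ) ^ 4) (-((Lc : ℝ) ^ 8 / 2)) cΛ (k + j)) -
      unitS (sfStep Lc k) (smStep 3 Lc k) (ScombOf (symTablesAn1S2 3 Lc cΛ) ((Lc : ℝ) ^ 4) (-((Lc : ℝ) ^ 8 / 2)) cΛ k)) (cS * θS ^ k) δS)
    (hδS : 0 < δS) (hθS0 : 0 ≤ θS) (hθS1 : θS < 1)
    -- (d″) THE COMB-CHART `T₂` TOWER CONSERVES ITS LEG-AND-BOND-SYMMETRISED ff ZERO-MODE CHARGE, level by level (in place of the (C)^{ev} row `hC`)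
    (hcons2 : ∀ (l : ℕ) (κ κ' κ₁ κ₂ : Fin (3 + 1)),
      (zmode Lc (unitS₂ (sfStep Lc (l + 1)) (smStep 3 Lc (l + 1)) (T2RecOf 3 Lc (GcombSh Lc) (SpureCombOf (symTablesAn1S2 3 Lc cΛ) ((Lc : ℝ) ^ 4) (-((Lc : ℝ) ^ 8 / 2)) cΛ) (symTablesAn1S2 3 Lc cΛ).M ((Lc : ℝ) ^ 8) cB ((8 * (N : ℝ) ^ 2)⁻¹ • wsym22 N) (symTablesAn1S2 3 Lc cΛ).vh₂S (symTablesAn1S2 3 Lc cΛ).mixFF (l + 1))) κ κ' (Sum.inl κ₁) (Sum.inl κ₂)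
          + zmode Lc (unitS₂ (sfStep Lc (l + 1)) (smStep 3 Lc (l + 1)) (T2RecOf 3 Lc (GcombSh Lc) (SpureCombOf (symTablesAn1S2 3 Lc cΛ) ((Lc : ℝ) ^ 4) (-((Lc : ℝ) ^ 8 / 2)) cΛ) (symTablesAn1S2 3 Lc cΛ).M ((Lc : ℝ) ^ 8) cB ((8 * (N : ℝ) ^ 2)⁻¹ • wsym22 N) (symTablesAn1S2 3 Lc cΛ).vh₂S (symTablesAn1S2 3 Lc cΛ).mixFF (l + 1))) κ' κ (Sum.inl κ₁) (Sum.inl κ₂))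
        + (zmode Lc (unitS₂ (sfStep Lc (l + 1)) (smStep 3 Lc (l + 1)) (T2RecOf 3 Lc (GcombSh Lc) (SpureCombOf (symTablesAn1S2 3 Lc cΛ) ((Lc : ℝ) ^ 4) (-((Lc : ℝ) ^ 8 / 2)) cΛ) (symTablesAn1S2 3 Lc cΛ).M ((Lc : ℝ) ^ 8) cB ((8 * (N : ℝ) ^ 2)⁻¹ • wsym22 N) (symTablesAn1S2 3 Lc cΛ).vh₂S (symTablesAn1S2 3 Lc cΛ).mixFF (l + 1))) κ κ' (Sum.inl κ₂) (Sum.inl κ₁)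
          + zmode Lc (unitS₂ (sfStep Lc (l + 1)) (smStep 3 Lc (l + 1)) (T2RecOf 3 Lc (GcombSh Lc) (SpureCombOf (symTablesAn1S2 3 Lc cΛ) ((Lc : ℝ) ^ 4) (-((Lc : ℝ) ^ 8 / 2)) cΛ) (symTablesAn1S2 3 Lc cΛ).M ((Lc : ℝ) ^ 8) cB ((8 * (N : ℝ) ^ 2)⁻¹ • wsym22 N) (symTablesAn1S2 3 Lc cΛ).vh₂S (symTablesAn1S2 3 Lc cΛ).mixFF (l + 1))) κ' κ (Sum.inl κ₂) (Sum.inl κ₁))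
      = (zmode Lc (unitS₂ (sfStep Lc l) (smStep 3 Lc l) (T2RecOf 3 Lc (GcombSh Lc) (SpureCombOf (symTablesAn1S2 3 Lc cΛ) ((Lc : ℝ) ^ 4) (-((Lc : ℝ) ^ 8 / 2)) cΛ) (symTablesAn1S2 3 Lc cΛ).M ((Lc : ℝ) ^ 8) cB ((8 * (N : ℝ) ^ 2)⁻¹ • wsym22 N) (symTablesAn1S2 3 Lc cΛ).vh₂S (symTablesAn1S2 3 Lc cΛ).mixFF l)) κ κ' (Sum.inl κ₁) (Sum.inl κ₂)
            + zmode Lc (unitS₂ (sfStep Lc l) (smStep 3 Lc l) (T2RecOf 3 Lc (GcombSh Lc) (SpureCombOf (symTablesAn1S2 3 Lc cΛ) ((Lc : ℝ) ^ 4) (-((Lc : ℝ) ^ 8 / 2)) cΛ) (symTablesAn1S2 3 Lc cΛ).M ((Lc : ℝ) ^ 8) cB ((8 * (N : ℝ) ^ 2)⁻¹ • wsym22 N) (symTablesAn1S2 3 Lc cΛ).vh₂S (symTablesAn1S2 3 Lc cΛ).mixFF l)) κ' κ (Sum.inl κ₁) (Sum.inl κ₂))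
          + (zmode Lc (unitS₂ (sfStep Lc l) (smStep 3 Lc l) (T2RecOf 3 Lc (GcombSh Lc) (SpureCombOf (symTablesAn1S2 3 Lc cΛ) ((Lc : ℝ) ^ 4) (-((Lc : ℝ) ^ 8 / 2)) cΛ) (symTablesAn1S2 3 Lc cΛ).M ((Lc : ℝ) ^ 8) cB ((8 * (N : ℝ) ^ 2)⁻¹ • wsym22 N) (symTablesAn1S2 3 Lc cΛ).vh₂S (symTablesAn1S2 3 Lc cΛ).mixFF l)) κ κ' (Sum.inl κ₂) (Sum.inl κ₁)
            + zmode Lc (unitS₂ (sfStep Lc l) (smStep 3 Lc l) (T2RecOf 3 Lc (GcombSh Lc) (SpureCombOf (symTablesAn1S2 3 Lc cΛ) ((Lc : ℝ) ^ 4) (-((Lc : ℝ) ^ 8 / 2)) cΛ) (symTablesAn1S2 3 Lc cΛ).M ((Lc : ℝ) ^ 8) cB ((8 * (N : ℝ) ^ 2)⁻¹ • wsym22 N) (symTablesAn1S2 3 Lc cΛ).vh₂S (symTablesAn1S2 3 Lc cΛ).mixFF l)) κ' κ (Sum.inl κ₂) (Sum.inl κ₁)))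
    (μ ν : Fin 4) :
    ∃ κ θ : ℝ, 0 ≤ θ ∧ θ < 1 ∧ AllScalesSeq (fun j => B12Beta.secondMoment (TbalOf Lc (JsB12CombShSym hLc N (symTablesAn1S2 3 Lc cΛ) cΛ cB) j) μ ν) κ θ := by
  refine exists_allScalesSeq_JsB12CombShSym_an1_of_sRows_at_pin hLc hLc2 hN hΛ hcB hS hSall hδS hθS0 hθS1 ?_ μ ν
  have hpin : ((Lc : ℝ) ^ 8) = (Lc : ℝ) ^ (3 + 5) := by norm_num
  have hrow := fun (l : ℕ) (κ κ' κ₁ κ₂ : Fin (3 + 1)) =>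
    (legBondSymSource_comb_eq_zero_iff (d := 3) (symTablesAn1S2 3 Lc cΛ) ((Lc : ℝ) ^ 4) (-((Lc : ℝ) ^ 8 / 2)) cΛ ((Lc : ℝ) ^ 8) cB
      ((8 * (N : ℝ) ^ 2)⁻¹ • wsym22 N) hpin l κ κ' κ₁ κ₂).2 (hcons2 l κ κ' κ₁ κ₂)
  intro l κ κ' κ₁ κ₂
  simpa only [one_smul] using
    zsym_relSource_comb_even_of_legBondSym (d := 3) (symTablesAn1S2 3 Lc cΛ) ((Lc : ℝ) ^ 4) (-((Lc : ℝ) ^ 8 / 2)) cΛ ((Lc : ℝ) ^ 8) cB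
      ((8 * (N : ℝ) ^ 2)⁻¹ • wsym22 N) (fun _ _ _ _ _ _ _ _ => rfl) (fun _ _ _ _ _ _ _ _ => rfl) hrow l κ κ' κ₁ κ₂

/-- NOT IN PRINT; OUR BOOKKEEPING.  **ROW D1's READING `↔ lim β = stepBal` AT THE LITERAL OF RECORD FROM (b) THE S-SLOT ROWS AND (d″) THE LEG-AND-BOND-SYMMETRISED CONSERVATION ROW**
(leaf-01 g83's `CombTowerEndAtPin.d1Drift_JsB12CombShSym_an1_iff_lim_eq_of_sRows_at_pin` with `hC` supplied as in the previous theorem; the VALUE `lim β = stepBal Nc Lc` is row D1's and is NOT proved). -/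
theorem d1Drift_JsB12CombShSym_an1_iff_lim_eq_of_sRows_legBondSymConserved (hLc : Odd Lc) (hLc2 : 2 ≤ Lc) {N : ℕ} (hN : 2 ≤ N) {cΛ cB : ℝ} (hΛ : cΛ * (Lc : ℝ) ^ 4 = 2) (hcB : cB = -((Lc : ℝ) ^ 12 / 4))
    {Cs cS θS δS : ℝ}
    (hS : ∀ j, LocStencil (unitS (sfStep Lc j) (smStep 3 Lc j) (ScombOf (symTablesAn1S2 3 Lc cΛ) ((Lc : ℝ) ^ 4) (-((Lc : ℝ) ^ 8 / 2)) cΛ j)) Cs δS)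
    (hSall : ∀ k j, LocStencil (unitS (sfStep Lc (k + j)) (smStep 3 Lc (k + j)) (ScombOf (symTablesAn1S2 3 Lc cΛ) ((Lc : ℝ) ^ 4) (-((Lc : ℝ) ^ 8 / 2)) cΛ (k + j)) -
      unitS (sfStep Lc k) (smStep 3 Lc k) (ScombOf (symTablesAn1S2 3 Lc cΛ) ((Lc : ℝ) ^ 4) (-((Lc : ℝ) ^ 8 / 2)) cΛ k)) (cS * θS ^ k) δS)
    (hδS : 0 < δS) (hθS0 : 0 ≤ θS) (hθS1 : θS < 1)
    -- (d″) THE COMB-CHART `T₂` TOWER CONSERVES ITS LEG-AND-BOND-SYMMETRISED ff ZERO-MODE CHARGE, level by level (in place of the (C)^{ev} row `hC`)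
    (hcons2 : ∀ (l : ℕ) (κ κ' κ₁ κ₂ : Fin (3 + 1)),
      (zmode Lc (unitS₂ (sfStep Lc (l + 1)) (smStep 3 Lc (l + 1)) (T2RecOf 3 Lc (GcombSh Lc) (SpureCombOf (symTablesAn1S2 3 Lc cΛ) ((Lc : ℝ) ^ 4) (-((Lc : ℝ) ^ 8 / 2)) cΛ) (symTablesAn1S2 3 Lc cΛ).M ((Lc : ℝ) ^ 8) cB ((8 * (N : ℝ) ^ 2)⁻¹ • wsym22 N) (symTablesAn1S2 3 Lc cΛ).vh₂S (symTablesAn1S2 3 Lc cΛ).mixFF (l + 1))) κ κ' (Sum.inl κ₁) (Sum.inl κ₂)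
          + zmode Lc (unitS₂ (sfStep Lc (l + 1)) (smStep 3 Lc (l + 1)) (T2RecOf 3 Lc (GcombSh Lc) (SpureCombOf (symTablesAn1S2 3 Lc cΛ) ((Lc : ℝ) ^ 4) (-((Lc : ℝ) ^ 8 / 2)) cΛ) (symTablesAn1S2 3 Lc cΛ).M ((Lc : ℝ) ^ 8) cB ((8 * (N : ℝ) ^ 2)⁻¹ • wsym22 N) (symTablesAn1S2 3 Lc cΛ).vh₂S (symTablesAn1S2 3 Lc cΛ).mixFF (l + 1))) κ' κ (Sum.inl κ₁) (Sum.inl κ₂))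
        + (zmode Lc (unitS₂ (sfStep Lc (l + 1)) (smStep 3 Lc (l + 1)) (T2RecOf 3 Lc (GcombSh Lc) (SpureCombOf (symTablesAn1S2 3 Lc cΛ) ((Lc : ℝ) ^ 4) (-((Lc : ℝ) ^ 8 / 2)) cΛ) (symTablesAn1S2 3 Lc cΛ).M ((Lc : ℝ) ^ 8) cB ((8 * (N : ℝ) ^ 2)⁻¹ • wsym22 N) (symTablesAn1S2 3 Lc cΛ).vh₂S (symTablesAn1S2 3 Lc cΛ).mixFF (l + 1))) κ κ' (Sum.inl κ₂) (Sum.inl κ₁)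
          + zmode Lc (unitS₂ (sfStep Lc (l + 1)) (smStep 3 Lc (l + 1)) (T2RecOf 3 Lc (GcombSh Lc) (SpureCombOf (symTablesAn1S2 3 Lc cΛ) ((Lc : ℝ) ^ 4) (-((Lc : ℝ) ^ 8 / 2)) cΛ) (symTablesAn1S2 3 Lc cΛ).M ((Lc : ℝ) ^ 8) cB ((8 * (N : ℝ) ^ 2)⁻¹ • wsym22 N) (symTablesAn1S2 3 Lc cΛ).vh₂S (symTablesAn1S2 3 Lc cΛ).mixFF (l + 1))) κ' κ (Sum.inl κ₂) (Sum.inl κ₁))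
      = (zmode Lc (unitS₂ (sfStep Lc l) (smStep 3 Lc l) (T2RecOf 3 Lc (GcombSh Lc) (SpureCombOf (symTablesAn1S2 3 Lc cΛ) ((Lc : ℝ) ^ 4) (-((Lc : ℝ) ^ 8 / 2)) cΛ) (symTablesAn1S2 3 Lc cΛ).M ((Lc : ℝ) ^ 8) cB ((8 * (N : ℝ) ^ 2)⁻¹ • wsym22 N) (symTablesAn1S2 3 Lc cΛ).vh₂S (symTablesAn1S2 3 Lc cΛ).mixFF l)) κ κ' (Sum.inl κ₁) (Sum.inl κ₂)
            + zmode Lc (unitS₂ (sfStep Lc l) (smStep 3 Lc l) (T2RecOf 3 Lc (GcombSh Lc) (SpureCombOf (symTablesAn1S2 3 Lc cΛ) ((Lc : ℝ) ^ 4) (-((Lc : ℝ) ^ 8 / 2)) cΛ) (symTablesAn1S2 3 Lc cΛ).M ((Lc : ℝ) ^ 8) cB ((8 * (N : ℝ) ^ 2)⁻¹ • wsym22 N) (symTablesAn1S2 3 Lc cΛ).vh₂S (symTablesAn1S2 3 Lc cΛ).mixFF l)) κ' κ (Sum.inl κ₁) (Sum.inl κ₂))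
          + (zmode Lc (unitS₂ (sfStep Lc l) (smStep 3 Lc l) (T2RecOf 3 Lc (GcombSh Lc) (SpureCombOf (symTablesAn1S2 3 Lc cΛ) ((Lc : ℝ) ^ 4) (-((Lc : ℝ) ^ 8 / 2)) cΛ) (symTablesAn1S2 3 Lc cΛ).M ((Lc : ℝ) ^ 8) cB ((8 * (N : ℝ) ^ 2)⁻¹ • wsym22 N) (symTablesAn1S2 3 Lc cΛ).vh₂S (symTablesAn1S2 3 Lc cΛ).mixFF l)) κ κ' (Sum.inl κ₂) (Sum.inl κ₁)
            + zmode Lc (unitS₂ (sfStep Lc l) (smStep 3 Lc l) (T2RecOf 3 Lc (GcombSh Lc) (SpureCombOf (symTablesAn1S2 3 Lc cΛ) ((Lc : ℝ) ^ 4) (-((Lc : ℝ) ^ 8 / 2)) cΛ) (symTablesAn1S2 3 Lc cΛ).M ((Lc : ℝ) ^ 8) cB ((8 * (N : ℝ) ^ 2)⁻¹ • wsym22 N) (symTablesAn1S2 3 Lc cΛ).vh₂S (symTablesAn1S2 3 Lc cΛ).mixFF l)) κ' κ (Sum.inl κ₂) (Sum.inl κ₁)))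
    (μ ν : Fin 4) (Nc : ℝ) :
    D1Drift Lc (JsB12CombShSym hLc N (symTablesAn1S2 3 Lc cΛ) cΛ cB) Nc μ ν ↔
      RateCertificate.CauchyRate.lim (fun j => B12Beta.secondMoment (TbalOf Lc (JsB12CombShSym hLc N (symTablesAn1S2 3 Lc cΛ) cΛ cB) j) μ ν) =
        B12Normalization.stepBal Nc Lc := by
  refine d1Drift_JsB12CombShSym_an1_iff_lim_eq_of_sRows_at_pin hLc hLc2 hN hΛ hcB hS hSall hδS hθS0 hθS1 ?_ μ ν Nc
  have hpin : ((Lc : ℝ) ^ 8) = (Lc : ℝ) ^ (3 + 5) := by norm_num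
  have hrow := fun (l : ℕ) (κ κ' κ₁ κ₂ : Fin (3 + 1)) =>
    (legBondSymSource_comb_eq_zero_iff (d := 3) (symTablesAn1S2 3 Lc cΛ) ((Lc : ℝ) ^ 4) (-((Lc : ℝ) ^ 8 / 2)) cΛ ((Lc : ℝ) ^ 8) cB
      ((8 * (N : ℝ) ^ 2)⁻¹ • wsym22 N) hpin l κ κ' κ₁ κ₂).2 (hcons2 l κ κ' κ₁ κ₂)
  intro l κ κ' κ₁ κ₂
  simpa only [one_smul] using
    zsym_relSource_comb_even_of_legBondSym (d := 3) (symTablesAn1S2 3 Lc cΛ) ((Lc : ℝ) ^ 4) (-((Lc : ℝ) ^ 8 / 2)) cΛ ((Lc : ℝ) ^ 8) cB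
      ((8 * (N : ℝ) ^ 2)⁻¹ • wsym22 N) (fun _ _ _ _ _ _ _ _ => rfl) (fun _ _ _ _ _ _ _ _ => rfl) hrow l κ κ' κ₁ κ₂

end Summit.QuantumFields.BalabanUV.Beta.GAN24.CombChargeConservationRowLegSym

end
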